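import Summits.SmoothPoincare4.SmoothPoincare4.Theses.WeylBudget
import Literature.Geometry.Riemannian.WeylEnergy
import Literature.Geometry.Lorentzian.WeylConformal
import Literature.Geometry.Lorentzian.CurvatureNaturality
import Literature.Geometry.Lorentzian.IsometryProofs
import Literature.Geometry.Riemannian.WarpedSeamMetric
import HarnessLib

/-!
# Bridge sub-goal T3 of crux `CorkRegluingBudget` (line `registered`, RESHAPE 3): the Weyl
# weight `ψ² |W|²` of the warped symmetric tube `ψ(t) ĥ ⊕ dt²` is profile-independent

Registered sub-goal `bridge_warpedTube_weylWeight` of `stub_warpedBridge` (item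
stmt-SmoothPoincare4-10831).  For a closed 3-manifold `Y`, a Riemannian metric `ĥ` on `Y`, smooth
positive profiles `ψ, ψ' : ℝ → ℝ` and ANY two smooth metrics `G, G'` on `Y × ℝ` (model
`(𝓡 3).prod 𝓘(ℝ, ℝ)`) with Levi-Civita connections and warped values `ψ(t) ĥ ⊕ dt²`,
`ψ'(t) ĥ ⊕ dt²`: `ψ(t)² |W_G|²(z, t) = ψ'(t')² |W_{G'}|²(z, t')` for all `z, t, t'`.

Proof (everything proved here; no definitions, no named facts).  Both sides equal `|W_P|²(z, 0)`
for the Riemannian product `P = ĥ ⊕ ds²` (`exists_warpedSeamMetric`):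

* `weylNormSq_conformal_sq_prodLine` — the pointwise conformal law `|W_{Ω² g}|² = Ω⁻⁴ |W_g|²`
  (`PseudoRiemannianMetric.weylNormSq_conformal_sq`, Besse 1987, Thm. 1.159, stated in the tree for
  manifolds charted on their model normed space) transported to the product manifold `Y × ℝ`, whose
  model with corners `(𝓡 3).prod 𝓘(ℝ, ℝ)` equals `𝓘(ℝ, ℝ³ × ℝ)` (`modelWithCornersSelf_prod`);
* `warpedTube_weylWeight_eq_product` — for ONE warped metric `G = ψ(t) ĥ ⊕ dt²`:
  `ψ(t)² |W_G|²(z, t) = |W_P|²(z, 0)`.  With `S(r) = ∫_t^r ψ^{-1/2}` (smooth, `S' = ψ^{-1/2} ≠ 0`,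
  `S(t) = 0`) and the local diffeomorphism `Ξ(z, r) = (z, S r)`, the pull-back `Q = Ξ^* P`
  (`PseudoRiemannianMetric.comap`) has values `ĥ ⊕ ψ⁻¹ dt²`, so `G = (√ψ)² Q` and the conformal
  law gives `ψ² |W_G|² = |W_Q|²`, while naturality of the Weyl norm under local diffeomorphisms
  (`PseudoRiemannianMetric.weylNormSq_comap`, O'Neill 1983, Ch. 3, Prop. 3.59) gives
  `|W_Q|²(z, t) = |W_P|²(Ξ(z, t)) = |W_P|²(z, 0)`.

References: A. L. Besse, *Einstein manifolds* (1987), Thm. 1.159 [Besse1987]; B. O'Neill,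
*Semi-Riemannian Geometry* (1983), Ch. 3, Prop. 3.59 and Ch. 7, Def. 7.33 [ONeill1983].
-/

set_option linter.dupNamespace false

open scoped Manifold ContDiff Topology
open Set Function

noncomputable section

namespace Summit.SmoothPoincare4.SmoothPoincare4.Theorems.CorkRegluingBudget

open Literature.Geometry.Lorentzian Literature.Geometry.Lorentzian.PseudoRiemannianMetric
  Literature.Geometry.Riemannian

/-! ### Auxiliary one-variable calculus -/

/-- A primitive of a smooth function is smooth and has the integrand as derivative (fundamental
theorem of calculus; copy of the private helper of the landed profile file
`WeylBudgetCorkRegluingBudgetBridgeProfile.lean`). [folklore] -/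
private lemma primitive_smooth {g : ℝ → ℝ} (hg : ContDiff ℝ ∞ g) (a : ℝ) :
    ContDiff ℝ ∞ (fun t => ∫ s in a..t, g s) ∧
      ∀ t, HasDerivAt (fun t => ∫ s in a..t, g s) (g t) t := by
  have hd : ∀ t, HasDerivAt (fun t => ∫ s in a..t, g s) (g t) t := fun t =>
    (hg.continuous.integral_hasStrictDerivAt a t).hasDerivAt
  refine ⟨contDiff_infty_iff_deriv.2 ⟨fun t => (hd t).differentiableAt, ?_⟩, hd⟩
  have h : deriv (fun t => ∫ s in a..t, g s) = g := funext fun t => (hd t).deriv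
  rw [h]
  exact hg

/-! ### The pointwise conformal law of the Weyl norm on the product manifold `Y × ℝ` -/

/-- The pointwise conformal law `|W_{ψ² g}|² = ψ⁻⁴ |W_g|²` of `WeylConformal.lean` for a model with
corners `I` on the model space `E` itself which is (propositionally) EQUAL to `𝓘(ℝ, E)` — the
bookkeeping step (`subst`) that lets the law be used on a product manifold, whose model
`𝓘(ℝ, E₁).prod 𝓘(ℝ, E₂)` equals but is not definitionally `𝓘(ℝ, E₁ × E₂)`
(`modelWithCornersSelf_prod`). [cite: Besse1987, Thm. 1.159] -/
private theorem weylNormSq_conformal_sq_of_model_eq {E : Type*} [NormedAddCommGroup E]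
    [NormedSpace ℝ E] [FiniteDimensional ℝ E] [CompleteSpace E] (h3 : 3 ≤ Module.finrank ℝ E)
    {I : ModelWithCorners ℝ E E} (hI : I = 𝓘(ℝ, E))
    {X : Type*} [TopologicalSpace X] [ChartedSpace E X] [IsManifold I ∞ X]
    (g g' : PseudoRiemannianMetric I ∞ E (TangentSpace I : X → Type _))
    [g.HasLeviCivita] [g'.HasLeviCivita] (hg : g.IsRiemannian) {ψ : X → ℝ}
    (hψ : ContMDiff I 𝓘(ℝ) ∞ ψ) (hpos : ∀ x : X, 0 < ψ x)
    (hgg' : ∀ (x : X) (v w : TangentSpace I x), g'.val x v w = ψ x ^ 2 * g.val x v w)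
    (x : X) :
    g'.weylNormSq x = (ψ x ^ 4)⁻¹ * g.weylNormSq x := by
  subst hI
  exact weylNormSq_conformal_sq h3 g g' hg hψ hpos hgg' x

/-- **The pointwise conformal law of the Weyl norm on `Y × ℝ`** (`Y` a 3-manifold charted on
`ℝ³`, product model `(𝓡 3).prod 𝓘(ℝ, ℝ)`): for smooth metrics `G` (Riemannian), `G'` on `Y × ℝ`
with their Levi-Civita connections and a smooth positive `Ω` with `G' = Ω² G` pointwise,
`|W_{G'}|²(x) = (Ω(x)⁴)⁻¹ |W_G|²(x)` — `PseudoRiemannianMetric.weylNormSq_conformal_sq`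
(dimension `3 + 1 ≥ 3`) transported along `modelWithCornersSelf_prod :
𝓘(ℝ, ℝ³ × ℝ) = (𝓡 3).prod 𝓘(ℝ, ℝ)`. [cite: Besse1987, Thm. 1.159] -/
theorem weylNormSq_conformal_sq_prodLine (Y : Type*) [TopologicalSpace Y]
    [ChartedSpace (EuclideanSpace ℝ (Fin 3)) Y] [IsManifold (𝓡 3) ∞ Y]
    (G G' : PseudoRiemannianMetric ((𝓡 3).prod 𝓘(ℝ, ℝ)) ∞ (EuclideanSpace ℝ (Fin 3) × ℝ)
      (TangentSpace ((𝓡 3).prod 𝓘(ℝ, ℝ)) : Y × ℝ → Type _))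
    [G.HasLeviCivita] [G'.HasLeviCivita] (hG : G.IsRiemannian) {Ω : Y × ℝ → ℝ}
    (hΩ : ContMDiff ((𝓡 3).prod 𝓘(ℝ, ℝ)) 𝓘(ℝ) ∞ Ω) (hpos : ∀ x, 0 < Ω x)
    (hGG' : ∀ (x : Y × ℝ) (v w : TangentSpace ((𝓡 3).prod 𝓘(ℝ, ℝ)) x),
      G'.val x v w = Ω x ^ 2 * G.val x v w)
    (x : Y × ℝ) :
    G'.weylNormSq x = (Ω x ^ 4)⁻¹ * G.weylNormSq x := by
  have h3 : 3 ≤ Module.finrank ℝ (EuclideanSpace ℝ (Fin 3) × ℝ) := by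
    rw [Module.finrank_prod, finrank_euclideanSpace_fin, Module.finrank_self]
    norm_num
  have inst : IsManifold ((𝓡 3).prod 𝓘(ℝ, ℝ)) ∞ (Y × ℝ) := inferInstance
  exact @weylNormSq_conformal_sq_of_model_eq (EuclideanSpace ℝ (Fin 3) × ℝ) _ _ _ _ h3
    ((𝓡 3).prod 𝓘(ℝ, ℝ)) modelWithCornersSelf_prod.symm (Y × ℝ) _
    (prodChartedSpace (EuclideanSpace ℝ (Fin 3)) Y ℝ ℝ) inst G G' ‹G.HasLeviCivita›
    ‹G'.HasLeviCivita› hG Ω hΩ hpos hGG' x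

/-! ### The Weyl weight of one warped tube equals that of the product -/

/-- **`ψ(t)² |W_G|²(z, t) = |W_P|²(z, 0)` for the warped tube `G = ψ(t) ĥ ⊕ dt²` and the product
`P = ĥ ⊕ ds²`** on `Y × ℝ` (`ĥ` Riemannian, `ψ > 0` smooth; `G`, `P` any smooth metrics with these
values, with their Levi-Civita connections).  With `S(r) = ∫_t^r ψ^{-1/2}` and
`Ξ(z, r) = (z, S r)` (a local diffeomorphism), `Ξ^* P = ĥ ⊕ ψ⁻¹ dt²`, so `G = (√ψ)² · Ξ^* P`;
the conformal law (`weylNormSq_conformal_sq_prodLine`) gives `ψ² |W_G|² = |W_{Ξ^* P}|²` and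
naturality (`weylNormSq_comap`) gives `|W_{Ξ^* P}|²(z, t) = |W_P|²(z, S t) = |W_P|²(z, 0)`.
[cite: Besse1987, Thm. 1.159] [cite: ONeill1983, Ch. 3, Prop. 3.59] -/
theorem warpedTube_weylWeight_eq_product (Y : Type*) [TopologicalSpace Y]
    [ChartedSpace (EuclideanSpace ℝ (Fin 3)) Y] [IsManifold (𝓡 3) ∞ Y]
    (ĥ : PseudoRiemannianMetric (𝓡 3) ∞ (EuclideanSpace ℝ (Fin 3)) (TangentSpace (𝓡 3) : Y → Type _))
    (hĥ : ĥ.IsRiemannian)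
    (P : PseudoRiemannianMetric ((𝓡 3).prod 𝓘(ℝ, ℝ)) ∞ (EuclideanSpace ℝ (Fin 3) × ℝ)
      (TangentSpace ((𝓡 3).prod 𝓘(ℝ, ℝ)) : Y × ℝ → Type _)) [P.HasLeviCivita]
    (hP : ∀ (p : Y × ℝ) (V W : TangentSpace ((𝓡 3).prod 𝓘(ℝ, ℝ)) p),
      P.val p V W = ĥ.val p.1 V.1 W.1 + V.2 * W.2)
    {ψ : ℝ → ℝ} (hψ : ContDiff ℝ ∞ ψ) (hpos : ∀ t, 0 < ψ t)
    (G : PseudoRiemannianMetric ((𝓡 3).prod 𝓘(ℝ, ℝ)) ∞ (EuclideanSpace ℝ (Fin 3) × ℝ)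
      (TangentSpace ((𝓡 3).prod 𝓘(ℝ, ℝ)) : Y × ℝ → Type _)) [G.HasLeviCivita]
    (hG : ∀ (p : Y × ℝ) (V W : TangentSpace ((𝓡 3).prod 𝓘(ℝ, ℝ)) p),
      G.val p V W = ψ p.2 * ĥ.val p.1 V.1 W.1 + V.2 * W.2)
    (z : Y) (t : ℝ) : ψ t ^ 2 * G.weylNormSq (z, t) = P.weylNormSq (z, 0) := by
  -- `P` is Riemannian
  have hPR : P.IsRiemannian := by
    intro q V hV
    rw [hP]
    rcases eq_or_ne V.1 0 with h1 | h1
    · have h2 : V.2 ≠ 0 := fun h2 ↦ hV (Prod.ext h1 h2)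
      have h0 : ĥ.val q.1 V.1 = 0 := by rw [h1]; exact map_zero _
      rw [h0]
      simpa using mul_self_pos.2 h2
    · have : 0 < ĥ.val q.1 V.1 V.1 := hĥ q.1 V.1 h1
      nlinarith [mul_self_nonneg V.2]
  -- the reparametrisation `S' = ρ = ψ^{-1/2}`, `S t = 0`
  set ρ : ℝ → ℝ := fun r ↦ (Real.sqrt (ψ r))⁻¹ with hρ
  have hsqrt_pos : ∀ r, 0 < Real.sqrt (ψ r) := fun r ↦ Real.sqrt_pos.2 (hpos r)
  have hρs : ContDiff ℝ ∞ ρ :=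
    (hψ.sqrt fun r ↦ (hpos r).ne').inv fun r ↦ (hsqrt_pos r).ne'
  have hρ0 : ∀ r, ρ r ≠ 0 := fun r ↦ inv_ne_zero (hsqrt_pos r).ne'
  have hρsq : ∀ r, ψ r * (ρ r * ρ r) = 1 := fun r ↦ by
    have h := Real.mul_self_sqrt (hpos r).le
    simp only [hρ]
    rw [← mul_inv, h, mul_inv_cancel₀ (hpos r).ne']
  obtain ⟨hSs, hSd⟩ := primitive_smooth hρs t
  set S : ℝ → ℝ := fun r ↦ ∫ s in t..r, ρ s with hS
  have hS0 : S t = 0 := intervalIntegral.integral_same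
  -- the local diffeomorphism `Ξ (z, r) = (z, S r)` and its differential `(V₁, V₂) ↦ (V₁, ρ V₂)`
  set Ξ : Y × ℝ → Y × ℝ := fun p ↦ (p.1, S p.2) with hΞ
  have hΞs : ContMDiff ((𝓡 3).prod 𝓘(ℝ, ℝ)) ((𝓡 3).prod 𝓘(ℝ, ℝ)) (∞ + 1) Ξ := by
    have h : ((∞ : ℕ∞ω) + 1) = ∞ := rfl
    rw [h]
    exact contMDiff_fst.prodMk (hSs.contMDiff.comp contMDiff_snd)
  have hΞD : ∀ p : Y × ℝ, HasMFDerivAt ((𝓡 3).prod 𝓘(ℝ, ℝ)) ((𝓡 3).prod 𝓘(ℝ, ℝ)) Ξ p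
      ((ContinuousLinearMap.fst ℝ (TangentSpace (𝓡 3) p.1) (TangentSpace 𝓘(ℝ, ℝ) p.2)).prod
        ((ContinuousLinearMap.smulRight (1 : ℝ →L[ℝ] ℝ) (ρ p.2)).comp
          (ContinuousLinearMap.snd ℝ (TangentSpace (𝓡 3) p.1) (TangentSpace 𝓘(ℝ, ℝ) p.2)))) :=
    fun p ↦ (hasMFDerivAt_fst p).prodMk
      ((hSd p.2).hasFDerivAt.hasMFDerivAt.comp p (hasMFDerivAt_snd p))
  have hΞDapply : ∀ (p : Y × ℝ) (V : TangentSpace ((𝓡 3).prod 𝓘(ℝ, ℝ)) p),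
      mfderiv ((𝓡 3).prod 𝓘(ℝ, ℝ)) ((𝓡 3).prod 𝓘(ℝ, ℝ)) Ξ p V = (V.1, V.2 * ρ p.2) := by
    intro p V
    rw [(hΞD p).mfderiv]
    rfl
  have hΞinj : ∀ p : Y × ℝ,
      Function.Injective (mfderiv ((𝓡 3).prod 𝓘(ℝ, ℝ)) ((𝓡 3).prod 𝓘(ℝ, ℝ)) Ξ p) := by
    intro p V W hVW
    rw [hΞDapply, hΞDapply] at hVW
    obtain ⟨h1, h2⟩ := Prod.mk.inj hVW
    exact Prod.ext h1 (mul_right_cancel₀ (hρ0 p.2) h2)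
  have hpb := contMDiff_pullbackBilin_holds (I := (𝓡 3).prod 𝓘(ℝ, ℝ)) (M := Y × ℝ)
    (I' := (𝓡 3).prod 𝓘(ℝ, ℝ)) (N := Y × ℝ) (n := (∞ : ℕ∞ω))
  -- the pulled-back metric `Q = Ξ^* P = ĥ ⊕ ψ⁻¹ dt²`
  set Q := P.comap hpb Ξ hΞs hΞinj rfl with hQ
  haveI : Q.HasLeviCivita := Q.hasLeviCivita
  have hQval : ∀ (p : Y × ℝ) (V W : TangentSpace ((𝓡 3).prod 𝓘(ℝ, ℝ)) p),
      Q.val p V W = ĥ.val p.1 V.1 W.1 + V.2 * ρ p.2 * (W.2 * ρ p.2) := by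
    intro p V W
    rw [hQ, val_comap, pullbackBilin_apply, hΞDapply, hΞDapply, hP]
  have hQR : Q.IsRiemannian := fun u v hv ↦ by
    simp only [hQ, val_comap, pullbackBilin_apply]
    exact hPR _ _ fun h0 ↦ hv (hΞinj u (by rw [map_zero]; exact h0))
  -- `G = (√ψ)² Q`, hence `|W_G|² = (√ψ)⁻⁴ |W_Q|²`
  have hΩs : ContMDiff ((𝓡 3).prod 𝓘(ℝ, ℝ)) 𝓘(ℝ) ∞ (fun p : Y × ℝ ↦ Real.sqrt (ψ p.2)) :=
    (hψ.sqrt fun r ↦ (hpos r).ne').comp_contMDiff contMDiff_snd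
  have hΩpos : ∀ p : Y × ℝ, 0 < Real.sqrt (ψ p.2) := fun p ↦ hsqrt_pos p.2
  have hGQ : ∀ (p : Y × ℝ) (V W : TangentSpace ((𝓡 3).prod 𝓘(ℝ, ℝ)) p),
      G.val p V W = Real.sqrt (ψ p.2) ^ 2 * Q.val p V W := by
    intro p V W
    rw [hG, hQval, Real.sq_sqrt (hpos p.2).le]
    linear_combination (-(V.2 * W.2)) * hρsq p.2
  have hconf : G.weylNormSq (z, t) = (Real.sqrt (ψ t) ^ 4)⁻¹ * Q.weylNormSq (z, t) :=
    weylNormSq_conformal_sq_prodLine Y Q G hQR hΩs hΩpos hGQ (z, t)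
  -- naturality: `|W_Q|²(z, t) = |W_P|²(Ξ (z, t)) = |W_P|²(z, 0)`
  have hnat : Q.weylNormSq (z, t) = P.weylNormSq (Ξ (z, t)) :=
    P.weylNormSq_comap hpb hΞs hΞinj rfl hPR (z, t)
  have hΞzt : Ξ (z, t) = (z, 0) := by
    simp only [hΞ, hS0]
  rw [hconf, hnat, hΞzt]
  have h4 : Real.sqrt (ψ t) ^ 4 = ψ t ^ 2 := by
    rw [show (4 : ℕ) = 2 * 2 from rfl, pow_mul, Real.sq_sqrt (hpos t).le]
  rw [h4, ← mul_assoc, mul_inv_cancel₀ (pow_ne_zero 2 (hpos t).ne'), one_mul]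

/-! ### T3 -/

/-- **T3 — the Weyl weight of the warped tube is profile-independent** (sub-goal
`bridge_warpedTube_weylWeight` of `stub_warpedBridge`, crux `CorkRegluingBudget`, line
`registered` RESHAPE 3).  For any two smooth metrics `G, G'` on `Y × ℝ` with warped values
`ψ(t) ĥ ⊕ dt²`, `ψ'(t) ĥ ⊕ dt²` (`ψ, ψ' > 0` smooth, `ĥ` Riemannian):
`ψ(t)² |W_G|²(z, t) = ψ'(t')² |W_{G'}|²(z, t')` for all `z, t, t'` — both equal `|W_P|²(z)` for
the product `P = ds² + ĥ` (conformal covariance `|W_{e^{2u}P}|² = e^{−4u}|W_P|²` in dimension 4,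
`G = ψ (ds² + ĥ)` with `ds = dt/√ψ`, naturality under the reparametrisation `(z, t) ↦ (z, s)`,
and translation invariance of `P` in `s`). [cite: Besse1987, (1.159)] [cite: ONeill1983, Ch. 3, Prop. 3.59] -/
theorem bridge_warpedTube_weylWeight :
    ∀ (Y : Type) [TopologicalSpace Y] [T2Space Y] [SecondCountableTopology Y] [CompactSpace Y]
      [ChartedSpace (EuclideanSpace ℝ (Fin 3)) Y] [IsManifold (𝓡 3) ∞ Y]
      (ĥ : Literature.Geometry.Lorentzian.PseudoRiemannianMetric (𝓡 3) ∞ (EuclideanSpace ℝ (Fin 3))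
        (TangentSpace (𝓡 3) : Y → Type _)) [ĥ.HasLeviCivita] (ψ ψ' : ℝ → ℝ)
      (G : Literature.Geometry.Lorentzian.PseudoRiemannianMetric ((𝓡 3).prod 𝓘(ℝ, ℝ)) ∞
        (EuclideanSpace ℝ (Fin 3) × ℝ) (TangentSpace ((𝓡 3).prod 𝓘(ℝ, ℝ)) : Y × ℝ → Type _))
      [G.HasLeviCivita]
      (G' : Literature.Geometry.Lorentzian.PseudoRiemannianMetric ((𝓡 3).prod 𝓘(ℝ, ℝ)) ∞
        (EuclideanSpace ℝ (Fin 3) × ℝ) (TangentSpace ((𝓡 3).prod 𝓘(ℝ, ℝ)) : Y × ℝ → Type _))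
      [G'.HasLeviCivita],
      ĥ.IsRiemannian → ContDiff ℝ ∞ ψ → (∀ t, 0 < ψ t) → ContDiff ℝ ∞ ψ' → (∀ t, 0 < ψ' t) →
      (∀ (p : Y × ℝ) (V W : TangentSpace ((𝓡 3).prod 𝓘(ℝ, ℝ)) p),
        G.val p V W = ψ p.2 * ĥ.val p.1 V.1 W.1 + V.2 * W.2) →
      (∀ (p : Y × ℝ) (V W : TangentSpace ((𝓡 3).prod 𝓘(ℝ, ℝ)) p),
        G'.val p V W = ψ' p.2 * ĥ.val p.1 V.1 W.1 + V.2 * W.2) →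
      ∀ (z : Y) (t t' : ℝ), ψ t ^ 2 * G.weylNormSq (z, t) = ψ' t' ^ 2 * G'.weylNormSq (z, t') := by
  intro Y _ _ _ _ _ _ ĥ _ ψ ψ' G _ G' _ hĥ hψ hψpos hψ' hψ'pos hG hG' z t t'
  -- the Riemannian product `P = ĥ ⊕ ds²` (warped seam metric with `a ≡ 1`, `F ≡ 1`)
  obtain ⟨P, -, hP⟩ := exists_warpedSeamMetric (I' := 𝓡 3) ĥ hĥ (a := fun _ : Y × ℝ ↦ (1 : ℝ))
    (F := fun _ : Y × ℝ ↦ (1 : ℝ)) contMDiff_const contMDiff_const (fun _ ↦ one_pos)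
    (fun _ ↦ one_pos)
  haveI : P.HasLeviCivita := P.hasLeviCivita
  have hP' : ∀ (p : Y × ℝ) (V W : TangentSpace ((𝓡 3).prod 𝓘(ℝ, ℝ)) p),
      P.val p V W = ĥ.val p.1 V.1 W.1 + V.2 * W.2 := fun p V W ↦ by
    rw [hP]; ring
  rw [warpedTube_weylWeight_eq_product Y ĥ hĥ P hP' hψ hψpos G hG z t,
    warpedTube_weylWeight_eq_product Y ĥ hĥ P hP' hψ' hψ'pos G' hG' z t']

end Summit.SmoothPoincare4.SmoothPoincare4.Theorems.CorkRegluingBudget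

end
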